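import Summits.Ventures.WeilGRH.UniformConductorFloorPrincipal
import HarnessLib

/-!
# GRH arm (rh-explicit, venture WeilGRH): TABLE-FREE multi-mode (Galerkin) refutations of Weil positivity for a real even
  character at a half-log window — the kernel evaluator, its soundness, and the principal character mod `38` at `(log 8)/2`

Cell `rh-explicit`, WEIL TRACK — GRH ARM (weil-grh-1, gen9).  gen8/gen9 refute `WeilPositivityOnChar χ a` for principal characters
with Yoshida's FLAT window `χ_0` (one Gram entry, `UniformConductorFloorPrincipal.lean` / `UniformConductorFloorPrincipalLog8.lean`).  When
the modulus sits between the flat threshold of its coprimality pattern and the true positivity threshold of its (level) pseudo-key form,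
the flat window is not negative and a finite combination `f = Σ_{|n| ≤ K} c_n χ_n` of Yoshida's basis (an even Galerkin vector,
`c_{-n} = c_n ∈ ℤ`) is needed: its twisted window form is `Σ_{n,m} c_n c_m · twistedGramCoeff χ a n m`
(`TwistedGramEvenReal.twistedWindowForm_sum_smul_chi_eq_twistedGramCoeff`, weil-grh-1 gen2) and a negative value refutes the rung
(`TwistedWindowClosure.not_weilPositivityOnChar_of_twistedWindowForm_sum_chi_neg`, weil-3).  This file supplies the KERNEL side with NO
special-value table: as in gen9's flat check, `π` (Machin), `a = (log b)/2`, the window constants (`Yoshida1992.Encl.consts`) and now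
the records of ALL modes `0 … K` (`Encl.idxRec`, negative modes by `IdxRec.flip`) are computed inside the `decide`, every Gram entry is
boxed by weil-grh-2's `TwistedEncl.twistedGramBox`, and the integer quadratic form is summed in interval arithmetic:

* `recAt`, `pairBox` (entry box at an arbitrary pair of integer modes; the negative diagonal through the reflection symmetry
  `twistedGramCoeff_neg_neg`), `symRow` / `symSum` (interval double sum over the upper triangle, by the symmetry `twistedGramCoeff_comm`), `galerkinCheckHalfLog` (the closed check);
* soundness `mem_pairBox`, `mem_symRow`, `mem_symSum`, ★ `not_weilPositivityOnChar_halfLog_of_galerkinCheck`.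

APPLICATION (§4): the modulus `38 = 2·19` at the window `(log 8)/2` — one of the two moduli left open by the `(log 8)/2` decision
(`UniformConductorFloorPrincipalLog8.lean`: flat threshold of the pattern `{2}` is `37.20 < 38`; typed floor `2 ∣ q ≥ 42`).  Even
Galerkin bottoms of the level-`2` pseudo-key form (float, 30 digits): `K = 24: 37.996`, `32: 38.023`, `40: 38.027`, `48: 38.035` —
the principal character mod `38` FAILS, by a margin `≈ 9·10⁻⁴` at `K = 48`.  The kernel fact `galerkinCheck_log8half_38` certifies
the integer witness of §4 (`K = 48`, coefficients = the bottom eigenvector at scale `10⁷`), whence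
`not_weilPositivityOnChar_log8half_principal_mod_38` and, with gen8's domination theorem read contrapositively, the all-characters
statement at `(log 8)/2` FAILS at `q = 38`.  RH/GRH-free (principal characters carry no polar term by the tree's convention);
computable `def`s with docstrings; standard axioms; no named facts.

## References

* H. Yoshida, *On Hermitian forms attached to zeta functions*, Adv. Stud. Pure Math. 21 (1992) 281–325, §3 (the basis `χ_n`),
  §5 (5.15)/(5.16) p. 301, §6 (6.10) p. 303. [Yoshida1992HermitianForms]
* R. E. Moore, *Interval Analysis* (1966), Ch. 3. [Moore1966]
* A. Weil, *Sur les "formules explicites" de la théorie des nombres premiers* (1952), (11) pp. 261–262. [Weil1952FormulesExplicites]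
(Re-landed unchanged by weil-grh-1 gen10 to re-trigger the hub build; declarations byte-identical.)
-/

set_option autoImplicit false

open Real Complex Finset
open scoped BigOperators ArithmeticFunction.vonMangoldt ComplexConjugate

namespace Summit.Ventures.WeilGRH

open Literature.NumberTheory.LFunctions Literature.NumberTheory.LFunctions.Yoshida1992
open Literature.NumberTheory.LFunctions.Yoshida1992.Encl
open Literature.Analysis.SpecialFunctions Literature.Analysis.ValidatedNumerics.NumericsMP
open TwistedEncl

namespace UniformFloor

variable {q : ℕ}

/-! ## §1 The kernel evaluator -/

/-- The record at an integer mode `n` from a table of records at the natural modes: `R_n` for `n ≥ 0`, the flipped record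
`R_{|n|}.flip` (odd fields negated, phases conjugated) for `n < 0`. [cite: Moore1966, Ch. 3 (interval arithmetic: inclusion property)] -/
def recAt (tab : List IdxRec) (n : ℤ) : IdxRec :=
  if 0 ≤ n then tget tab n.toNat else (tget tab n.natAbs).flip

/-- Box of the twisted Gram entry `twistedGramCoeff χ a n m` at an arbitrary pair of integer modes: records by `recAt`; a NEGATIVE
diagonal entry `(n, n)`, `n < 0`, is boxed as the entry `(−n, −n)` (reflection symmetry), so that diagonal records are only needed
at natural modes. [cite: Yoshida1992HermitianForms, §5 (5.15)-(5.16) p. 301] -/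
def pairBox (S : ℕ) (C : Consts) (εs : List ℤ) (LQ : MI) (tab : List IdxRec) (n m : ℤ) : MI :=
  if n = m ∧ n < 0 then twistedGramBox S C εs LQ (tget tab n.natAbs) (tget tab n.natAbs) (-n) (-n)
  else twistedGramBox S C εs LQ (recAt tab n) (recAt tab m) n m

/-- The even integer coefficient at the mode `n`: `c_n = cs[|n|]`. [folklore] -/
def coef (cs : List ℤ) (n : ℤ) : ℤ := cs.getD n.natAbs 0

/-- Interval column sum `Σ_{j<J} c_{j−K} c_{N−K} · B(j−K, N−K)` (modes shifted by `K`; the part of the column `N` above the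
diagonal). [cite: Moore1966, Ch. 3 (interval arithmetic: inclusion property)] -/
def symRow (S : ℕ) (B : ℤ → ℤ → MI) (cs : List ℤ) (K N : ℕ) : ℕ → MI
  | 0 => MI.ofInt S 0
  | j + 1 => (symRow S B cs K N j).add
      (((B ((j : ℤ) - K) ((N : ℤ) - K)).mulInt (coef cs ((j : ℤ) - K))).mulInt (coef cs ((N : ℤ) - K)))

/-- Interval value of the SYMMETRIC double sum `Σ_{i<N} Σ_{j<N} c_{i−K} c_{j−K} · G(i−K, j−K)` computed over the upper triangle only:
`T(N+1) = T(N) + 2·Σ_{j<N} c_j c_N B(j,N) + c_N² B(N,N)` (`G` symmetric; `N(N+1)/2` boxes instead of `N²`).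
[cite: Moore1966, Ch. 3 (interval arithmetic: inclusion property)] -/
def symSum (S : ℕ) (B : ℤ → ℤ → MI) (cs : List ℤ) (K : ℕ) : ℕ → MI
  | 0 => MI.ofInt S 0
  | N + 1 => ((symSum S B cs K N).add ((symRow S B cs K N N).mulInt 2)).add
      (((B ((N : ℤ) - K) ((N : ℤ) - K)).mulInt (coef cs ((N : ℤ) - K))).mulInt (coef cs ((N : ℤ) - K)))

/-- **The table-free Galerkin check at the window `a = (log b)/2` for the modulus `q`.**  Compute `π`, `a`, the window constants,
the records of the modes `0 … K` and `log q`; box every entry `twistedGramCoeff χ a n m`, `|n|, |m| ≤ K`, with prime signs `εs`; sum the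
integer quadratic form with even coefficients `cs`; test that its upper end is negative. [cite: Moore1966, Ch. 3 (interval arithmetic: inclusion property)] -/
def galerkinCheckHalfLog (prm : Params) (Kpi b q K : ℕ) (ks : List PrimeLen) (εs cs : List ℤ) : Option Bool :=
  (MI.piMachin prm.S Kpi).bind fun P ↦ (MI.logNat2 prm.S prm.Kser b).bind fun L ↦
    (consts prm P (L.divNat 2) ks).bind fun C ↦ (omap (idxRec prm C) (List.range (K + 1))).bind fun tab ↦
    (MI.logNat2 prm.S prm.Kser q).map fun LQ ↦
      decide ((symSum prm.S (pairBox prm.S C εs LQ tab) cs K (2 * K + 1)).hi < 0)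

/-! ## §2 Soundness of the entry boxes -/

section Sound

variable {S : ℕ} {a : ℝ} {ks : List PrimeLen} {K : ℕ} {tab : List IdxRec}

/-- Off-diagonal validity of `recAt` at every integer mode `|n| ≤ K` (negative modes by `OffValid.flip`). [cite: Moore1966, Ch. 3 (interval arithmetic: inclusion property)] -/
theorem offValid_recAt (htab : TabValid S a ks (K + 1) tab) {n : ℤ} (hn : n.natAbs ≤ K) : OffValid S a ks n (recAt tab n) := by
  unfold recAt
  split_ifs with h0
  · have h := (htab n.toNat (by omega)).1
    rwa [show ((n.toNat : ℕ) : ℤ) = n by omega] at h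
  · have h := (htab n.natAbs (by omega)).1.flip
    rwa [show -((n.natAbs : ℕ) : ℤ) = n by omega] at h

/-- Diagonal validity of `recAt` at a natural mode. [cite: Moore1966, Ch. 3 (interval arithmetic: inclusion property)] -/
theorem diagValid_recAt (htab : TabValid S a ks (K + 1) tab) {n : ℤ} (hn0 : 0 ≤ n) (hn : n.natAbs ≤ K) :
    DiagValid S a n (recAt tab n) := by
  unfold recAt
  rw [if_pos hn0]
  have h := (htab n.toNat (by omega)).2
  rwa [show ((n.toNat : ℕ) : ℤ) = n by omega] at h

/-- **Soundness of `pairBox`**: `twistedGramCoeff χ a n m ∈ pairBox … n m` for `|n|, |m| ≤ K`. [cite: Yoshida1992HermitianForms, §5 (5.15)-(5.16) p. 301; Moore1966, Ch. 3 (interval arithmetic: inclusion property)] -/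
theorem mem_pairBox (hS : 0 < S) (ha0 : 0 < a) (hks : PrimeData a ks) {C : Consts} (hC : ConstsValid S a ks C)
    (χ : DirichletCharacter ℂ q) {εs : List ℤ}
    (hε : ∀ i < ks.length, (χ (((ks.getD i default).val : ℕ) : ZMod q)).re = ((εs.getD i 0 : ℤ) : ℝ))
    {LQ : MI} (hLQ : MI.mem S (Real.log q) LQ) (htab : TabValid S a ks (K + 1) tab)
    {n m : ℤ} (hn : n.natAbs ≤ K) (hm : m.natAbs ≤ K) :
    MI.mem S (twistedGramCoeff χ a n m) (pairBox S C εs LQ tab n m) := by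
  unfold pairBox
  split_ifs with h
  · obtain ⟨rfl, hneg⟩ := h
    have hcast : ((n.natAbs : ℕ) : ℤ) = -n := by omega
    obtain ⟨hoff, hdiag⟩ := htab n.natAbs (by omega)
    rw [hcast] at hoff hdiag
    rw [show twistedGramCoeff χ a n n = twistedGramCoeff χ a (-n) (-n) by
      rw [twistedGramCoeff_neg_neg]]
    exact mem_twistedGramBox hS ha0 hks hC χ hε hLQ hoff (fun _ ↦ hdiag) hoff
  · refine mem_twistedGramBox hS ha0 hks hC χ hε hLQ (offValid_recAt htab hn) (fun hnm ↦ ?_) (offValid_recAt htab hm)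
    have hn0 : 0 ≤ n := by
      by_contra hlt
      exact h ⟨hnm, by omega⟩
    exact diagValid_recAt htab hn0 hn

/-- Soundness of the column sum. [cite: Moore1966, Ch. 3 (interval arithmetic: inclusion property)] -/
theorem mem_symRow (B : ℤ → ℤ → MI) (g : ℤ → ℤ → ℝ) (cs : List ℤ) (N : ℕ) {J : ℕ}
    (hB : ∀ j < J, MI.mem S (g ((j : ℤ) - K) ((N : ℤ) - K)) (B ((j : ℤ) - K) ((N : ℤ) - K))) :
    ∀ J' ≤ J, MI.mem S (∑ j ∈ Finset.range J', (coef cs ((j : ℤ) - K) : ℝ) * (coef cs ((N : ℤ) - K) : ℝ) *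
        g ((j : ℤ) - K) ((N : ℤ) - K)) (symRow S B cs K N J')
  | 0, _ => by simpa [symRow] using MI.mem_ofInt S 0
  | J' + 1, hJ => by
    rw [Finset.sum_range_succ, symRow]
    refine MI.mem_add (mem_symRow B g cs N hB J' (by omega)) ?_
    have h := MI.mem_mulInt (MI.mem_mulInt (hB J' (by omega)) (coef cs ((J' : ℤ) - K))) (coef cs ((N : ℤ) - K))
    exact mem_of_eq h (by ring)

/-- Soundness of the symmetric double sum (`g` symmetric). [cite: Moore1966, Ch. 3 (interval arithmetic: inclusion property)] -/
theorem mem_symSum (B : ℤ → ℤ → MI) (g : ℤ → ℤ → ℝ) (hg : ∀ n m, g n m = g m n) (cs : List ℤ) {I : ℕ}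
    (hB : ∀ i < I, ∀ j < I, MI.mem S (g ((i : ℤ) - K) ((j : ℤ) - K)) (B ((i : ℤ) - K) ((j : ℤ) - K))) :
    ∀ N ≤ I, MI.mem S (∑ i ∈ Finset.range N, ∑ j ∈ Finset.range N, (coef cs ((i : ℤ) - K) : ℝ) *
        (coef cs ((j : ℤ) - K) : ℝ) * g ((i : ℤ) - K) ((j : ℤ) - K)) (symSum S B cs K N)
  | 0, _ => by simpa [symSum] using MI.mem_ofInt S 0
  | N + 1, hN => by
    -- peel the last row and the last column; by symmetry they agree
    set F : ℕ → ℕ → ℝ := fun i j ↦ (coef cs ((i : ℤ) - K) : ℝ) * (coef cs ((j : ℤ) - K) : ℝ) *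
      g ((i : ℤ) - K) ((j : ℤ) - K) with hF
    have hFs : ∀ i j, F i j = F j i := by
      intro i j
      simp only [hF, hg ((i : ℤ) - K) ((j : ℤ) - K)]
      ring
    have hsplit : ∑ i ∈ Finset.range (N + 1), ∑ j ∈ Finset.range (N + 1), F i j =
        ∑ i ∈ Finset.range N, ∑ j ∈ Finset.range N, F i j + (∑ j ∈ Finset.range N, F j N) * (2 : ℤ) + F N N := by
      rw [Finset.sum_range_succ]
      simp_rw [Finset.sum_range_succ]
      rw [Finset.sum_add_distrib]
      have hcol : ∑ j ∈ Finset.range N, F N j = ∑ j ∈ Finset.range N, F j N :=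
        Finset.sum_congr rfl fun j _ ↦ hFs N j
      rw [hcol]
      push_cast
      ring
    show MI.mem S (∑ i ∈ Finset.range (N + 1), ∑ j ∈ Finset.range (N + 1), F i j) _
    rw [hsplit, symSum]
    refine MI.mem_add (MI.mem_add (mem_symSum B g hg cs hB N (by omega)) ?_) ?_
    · exact MI.mem_mulInt (mem_symRow B g cs N (fun j hj ↦ hB j (by omega) N (by omega)) N le_rfl) 2
    · have h := MI.mem_mulInt (MI.mem_mulInt (hB N (by omega) N (by omega)) (coef cs ((N : ℤ) - K)))
        (coef cs ((N : ℤ) - K))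
      exact mem_of_eq h (by simp only [hF]; ring)

end Sound

/-! ## §3 The refutation theorem -/

/-- Re-indexing of a double sum over the modes `−K … K` by `i ↦ i − K` over `range (2K+1)`. [folklore] -/
theorem sum_sum_image_shift (K : ℕ) (g : ℤ → ℤ → ℝ) :
    ∑ n ∈ (Finset.range (2 * K + 1)).image (fun i : ℕ ↦ (i : ℤ) - K),
      ∑ m ∈ (Finset.range (2 * K + 1)).image (fun i : ℕ ↦ (i : ℤ) - K), g n m =
      ∑ i ∈ Finset.range (2 * K + 1), ∑ j ∈ Finset.range (2 * K + 1), g ((i : ℤ) - K) ((j : ℤ) - K) := by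
  have hinj : ∀ i ∈ Finset.range (2 * K + 1), ∀ j ∈ Finset.range (2 * K + 1),
      (i : ℤ) - K = (j : ℤ) - K → i = j := by
    intro i _ j _ h
    have : (i : ℤ) = j := by linarith
    exact_mod_cast this
  rw [Finset.sum_image hinj]
  refine Finset.sum_congr rfl fun i _ ↦ ?_
  rw [Finset.sum_image hinj]

/-- The coefficients are real integers: `Re(conj(c_n) c_m) = c_n c_m`. [folklore] -/
theorem re_conj_intCast_mul_intCast (k l : ℤ) : (conj ((k : ℤ) : ℂ) * ((l : ℤ) : ℂ)).re = (k : ℝ) * (l : ℝ) := by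
  simp [Complex.mul_re]

/-- ★ **Soundness of the table-free Galerkin check.**  If `galerkinCheckHalfLog prm Kpi b q K ks εs cs = some true` (`b ≥ 2`, certified
prime data `ks` of the window `(log b)/2`), then every real even character `χ` mod `q ≠ 1` with `Re χ(k_i) = ε_i` on the listed prime powers
FAILS `WeilPositivityOnChar χ ((log b)/2)`: the witness is `f = Σ_{|n| ≤ K} cs[|n|]·χ_n`, whose twisted window form
`Σ_{n,m} c_n c_m twistedGramCoeff χ a n m` lies in a box with negative upper end.
[cite: Yoshida1992HermitianForms, §5 (5.15)-(5.16) p. 301; Moore1966, Ch. 3 (interval arithmetic: inclusion property)] -/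
theorem not_weilPositivityOnChar_halfLog_of_galerkinCheck {prm : Params} (hS : 0 < prm.S) (hK : 1 ≤ prm.Kexp)
    {Kpi b K : ℕ} (hb : 1 < b) {ks : List PrimeLen} (hks : checkPrimeDataHalfLog b ks = true) {εs cs : List ℤ}
    (h : galerkinCheckHalfLog prm Kpi b q K ks εs cs = some true) (hq : q ≠ 1) (χ : DirichletCharacter ℂ q)
    (hreal : ∀ n : ℕ, conj (χ (n : ZMod q)) = χ (n : ZMod q)) (heven : charParity χ = 0)
    (hε : ∀ i < ks.length, (χ (((ks.getD i default).val : ℕ) : ZMod q)).re = ((εs.getD i 0 : ℤ) : ℝ)) :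
    ¬ WeilPositivityOnChar χ (Real.log b / 2) := by
  unfold galerkinCheckHalfLog at h
  simp only [Option.bind_eq_some_iff, Option.map_eq_some_iff, decide_eq_true_eq] at h
  obtain ⟨P, hP, L, hL, C, hC, tab, hT, LQ, hQ, hhi⟩ := h
  -- the certified inputs
  have hb1 : (1 : ℝ) < b := by exact_mod_cast hb
  have ha0 : (0 : ℝ) < Real.log b / 2 := div_pos (Real.log_pos hb1) two_pos
  have ha : MI.mem prm.S (Real.log b / 2) (L.divNat 2) := by
    have := MI.mem_divNat (MI.mem_logNat2 hS hL) (n := 2) (by norm_num)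
    exact mem_of_eq this (by push_cast; ring)
  have hCv : ConstsValid prm.S (Real.log b / 2) ks C := constsValid_of_consts hS hK (MI.mem_piMachin hS hP) ha hC
  have hprime : PrimeData (Real.log b / 2) ks := primeData_of_checkHalfLog hks
  have hLQ : MI.mem prm.S (Real.log q) LQ := MI.mem_logNat2 hS hQ
  -- the table of records of the modes `0 … K`
  obtain ⟨hlen, htabi⟩ := omap_spec hT
  have htab : TabValid prm.S (Real.log b / 2) ks (K + 1) tab := by
    intro n hn
    have hn' : n < (List.range (K + 1)).length := by simpa using hn
    have hr := htabi n hn'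
    rw [List.getD_eq_getElem?_getD, List.getElem?_range (by simpa using hn), Option.getD_some] at hr
    exact idxValid_of_idxRec hS ha0 hCv hr
  -- the boxed quadratic form is negative
  have hform : MI.mem prm.S (∑ i ∈ Finset.range (2 * K + 1), ∑ j ∈ Finset.range (2 * K + 1),
      (coef cs ((i : ℤ) - K) : ℝ) * (coef cs ((j : ℤ) - K) : ℝ) *
        twistedGramCoeff χ (Real.log b / 2) ((i : ℤ) - K) ((j : ℤ) - K))
      (symSum prm.S (pairBox prm.S C εs LQ tab) cs K (2 * K + 1)) :=
    mem_symSum (K := K) _ (fun n m ↦ twistedGramCoeff χ (Real.log b / 2) n m)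
      (fun n m ↦ twistedGramCoeff_comm χ _ n m) cs
      (fun i hi j hj ↦ mem_pairBox hS ha0 hprime hCv χ hε hLQ htab (by omega) (by omega)) _ le_rfl
  have hneg := MI.neg_of_hi_neg hform hhi
  -- the witness `f = Σ c_n χ_n` over the modes `−K … K`
  refine not_weilPositivityOnChar_of_twistedWindowForm_sum_chi_neg hq χ ha0
    (s := (Finset.range (2 * K + 1)).image (fun i : ℕ ↦ (i : ℤ) - K)) (c := fun n ↦ ((coef cs n : ℤ) : ℂ)) ?_
  rw [twistedWindowForm_sum_smul_chi_eq_twistedGramCoeff χ hreal heven ha0]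
  simp_rw [re_conj_intCast_mul_intCast]
  rw [sum_sum_image_shift K]
  exact hneg

/-! ## §4 The principal character mod `38` at `(log 8)/2` -/

/-- kernel: **the Galerkin witness for `χ₀` mod `38` at `(log 8)/2`** — `K = 28` (modes `|n| ≤ 28`), prime signs of the pattern
`{2}` (`ε = (0, 1, 0, 1, 1)` on `2, 3, 4, 5, 7`), even integer coefficients `c_0 … c_28` = the bottom eigenvector of the 28-mode even
Galerkin section of the level-`2` pseudo-key form at scale `10⁷` (float value of the form: `−3.566·10⁻⁴·Σ c_n²`); evaluator
`⟨2^80, 64, 8, 16, 40⟩`, `π` with 70 terms; `29·30/2·… = 1653` entry boxes; ≈ 145 s in the kernel.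
[cite: Moore1966, Ch. 3 (interval arithmetic: inclusion property)] -/
theorem galerkinCheck_log8half_38 :
    galerkinCheckHalfLog ⟨2 ^ 80, 64, 8, 16, 40⟩ 70 8 38 28 [⟨2, 1⟩, ⟨3, 1⟩, ⟨2, 2⟩, ⟨5, 1⟩, ⟨7, 1⟩] [0, 1, 0, 1, 1]
      [-9971327, 393463, 99405, -71614, 156714, 136147, 22198, -475, 182980, -31028,
      70862, -33083, 125868, -75937, 45268, -16369, 40573, -36914, 2809, 8491,
      -1062, -33413, 4312, -11257, -2151, -46682, 27277, -31988, 10893] = some true := by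
  decide +kernel

/-- ★★ **The principal character mod `38` FAILS Weil positivity on `[-(log 8)/2, (log 8)/2]`** — the razor case of the `(log 8)/2`
decision: flat threshold of its pattern `37.20 < 38 <` typed floor `42`; the 28-mode Galerkin witness is negative by `3.6·10⁻⁴`
(relative), kernel-certified. [cite: Yoshida1992HermitianForms, §5 (5.15)-(5.16) p. 301; Weil1952FormulesExplicites, (11) pp. 261–262] -/
theorem not_weilPositivityOnChar_log8half_principal_mod_38 :
    ¬ WeilPositivityOnChar (1 : DirichletCharacter ℂ 38) (Real.log 8 / 2) := by
  have hks : checkPrimeDataHalfLog 8 [⟨2, 1⟩, ⟨3, 1⟩, ⟨2, 2⟩, ⟨5, 1⟩, ⟨7, 1⟩] = true := by decide +kernel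
  refine not_weilPositivityOnChar_halfLog_of_galerkinCheck (prm := ⟨2 ^ 80, 64, 8, 16, 40⟩) (by norm_num) (by norm_num)
    (by norm_num) hks galerkinCheck_log8half_38 (by norm_num) 1 (fun n ↦ conj_one_apply _) charParity_one ?_
  intro i hi
  have hi5 : i < 5 := by simpa using hi
  interval_cases i
  · show ((1 : DirichletCharacter ℂ 38) ((2 ^ 1 : ℕ) : ZMod 38)).re = (((0 : ℤ) : ℤ) : ℝ)
    rw [re_one_apply_natCast, if_neg (by decide)]
    simp
  · show ((1 : DirichletCharacter ℂ 38) ((3 ^ 1 : ℕ) : ZMod 38)).re = (((1 : ℤ) : ℤ) : ℝ)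
    rw [re_one_apply_natCast, if_pos (by decide)]
    simp
  · show ((1 : DirichletCharacter ℂ 38) ((2 ^ 2 : ℕ) : ZMod 38)).re = (((0 : ℤ) : ℤ) : ℝ)
    rw [re_one_apply_natCast, if_neg (by decide)]
    simp
  · show ((1 : DirichletCharacter ℂ 38) ((5 ^ 1 : ℕ) : ZMod 38)).re = (((1 : ℤ) : ℤ) : ℝ)
    rw [re_one_apply_natCast, if_pos (by decide)]
    simp
  · show ((1 : DirichletCharacter ℂ 38) ((7 ^ 1 : ℕ) : ZMod 38)).re = (((1 : ℤ) : ℤ) : ℝ)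
    rw [re_one_apply_natCast, if_pos (by decide)]
    simp

/-- **So the all-characters statement at `(log 8)/2` fails at `q = 38`** (one of the two moduli left open by
`UniformConductorFloorPrincipalLog8.forall_weilPositivityOnChar_log8half_iff`). [cite: Weil1952FormulesExplicites, (11) pp. 261–262] -/
theorem exists_not_weilPositivityOnChar_log8half_thirtyEight :
    ∃ χ : DirichletCharacter ℂ 38, ¬ WeilPositivityOnChar χ (Real.log 8 / 2) :=
  ⟨1, not_weilPositivityOnChar_log8half_principal_mod_38⟩

end UniformFloor

end Summit.Ventures.WeilGRH
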